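import Literature.Topology.FourManifolds.GroupTrisectionsConnectSum
import Literature.Topology.FourManifolds.StandardTrisectionSlotSymmetry

/-!
# `NormalFormStablyTrivial` — line `Sketch`: handle calculus on kernel triples (I)

Support lemmas for the calibration of stub K1 (`StablyThreeHandleFree`) of the line `Sketch`
(crux `CongruenceShadows.NormalFormStablyTrivial`, item stmt-SmoothPoincare4-14591): relator-fixing
automorphisms of the surface group (`RelatorAut`, `StandardTrisectionSlotSymmetry.lean`) acting on
connected sums and on unbalanced stabilisations (`GroupTrisectionsConnectSum.lean`).

* `map_blockSum_connectSum` — the block sum `A ⊞ B` acts slot by slot on `K # L`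
  (generalises `map_blockSum_stabilize` from `stabilize = · # s4Kernels` to every connected sum);
  `map_blockSum_refl_stabilizeOne` — `A ⊞ 1` carries `K.stabilizeOne x` to `(A·K).stabilizeOne x`.
* `stabilizeOne_stabilizeOne_apply_eq` — normal generators of a double unbalanced stabilisation:
  lifts of `K_ι` on the first `g` handles and ONE new generator on each of the two new handles.
* `exists_swap_stabilizeOne` (registered sub-goal of the crux item) — **adjacent eyes commute up to
  a relator-fixing automorphism**: there is `S ∈ RelatorAut (g+2)` (identity on the first `g`
  handles, the relator-fixing transposition `a_g ↦ [a_g,b_g] a_{g+1} [a_g,b_g]⁻¹,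
  b_g ↦ [a_g,b_g] b_{g+1} [a_g,b_g]⁻¹, a_{g+1} ↦ a_g, b_{g+1} ↦ b_g` on the two new ones — the plain
  letter swap does not fix `∏[aᵢ,bᵢ]`) with
  `S · ((K.stabilizeOne x).stabilizeOne y) = (K.stabilizeOne y).stabilizeOne x` for all `K, x, y`.
* `exists_realiser_of_perm` — **handle permutations**: for pattern lists `l₁ ~ l₂` (a pattern list
  records, handle by handle, the direction of an unbalanced stabilisation of the genus-`0` triple;
  local notation `𝒫 l`), a relator-fixing automorphism carries `𝒫 l₁` (transported along the
  equality of lengths) onto `𝒫 l₂` slot by slot — induction on `List.Perm` over block sums and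
  the adjacent transposition.  Used by the companion file `…SketchCalibration.lean` to identify the
  standard triple `s4Kernels.stabilizeIter M` with a one-direction connected sum (stub K1 at `K = N`).

Everything is explicit algebra in `F⟨a₁,…,b_{g+2}⟩`; no named facts, no `sorry`.
References: D. Gay, R. Kirby, *Trisecting 4-manifolds*, Geom. Topol. 20 (2016), proof of Lemma 10
("one eye at a time"); A. Abrams, D. Gay, R. Kirby, Geom. Topol. 22 (2018), Def. 2–3.
-/

noncomputable section

-- the prescribed namespace `Summit.<P>.<Sub>.…` duplicates `SmoothPoincare4` (P = Sub)
set_option linter.dupNamespace false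

namespace Summit.SmoothPoincare4.SmoothPoincare4.Theorems.NormalFormStablyTrivial.Sketch

open Literature.Topology.FourManifolds Subgroup RelatorAut

variable {g g' : ℕ}

/-! ## 1. Block sums act slot by slot on connected sums -/

/-- The block sum `A ⊞ B` of relator-fixing automorphisms acts slot by slot on the connected sum
`K # L`. [folklore] -/
theorem map_blockSum_connectSum (A : RelatorAut g) (B : RelatorAut g') (K : TrisectionKernels g)
    (L : TrisectionKernels g') (i : Fin 3) :
    (K.connectSum L i).map (A.blockSum B).toMulEquiv.toMonoidHom =
      TrisectionKernels.connectSum (fun i => (K i).map A.toMulEquiv.toMonoidHom)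
        (fun i => (L i).map B.toMulEquiv.toMonoidHom) i := by
  rw [TrisectionKernels.connectSum_apply, TrisectionKernels.connectSum_apply,
    Subgroup.map_normalClosure _ _ (by exact (A.blockSum B).toMulEquiv.surjective)]
  congr 1
  simp only [Set.image_union, Set.image_image, ← image_hom_preimage_mk]
  congr 1
  · refine Set.image_congr' fun w => ?_
    simp only [Function.comp_apply, MulEquiv.coe_toMonoidHom, toMulEquiv_mk]
    rw [blockSum_hom_genInclAdd]
  · refine Set.image_congr' fun w => ?_
    simp only [Function.comp_apply, MulEquiv.coe_toMonoidHom, toMulEquiv_mk]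
    rw [blockSum_hom_genShiftAdd]

/-- `A ⊞ 1` carries `K.stabilizeOne x` to the unbalanced stabilisation of `A · K`. [folklore] -/
theorem map_blockSum_refl_stabilizeOne (A : RelatorAut g) (K : TrisectionKernels g) (x i : Fin 3) :
    (K.stabilizeOne x i).map (A.blockSum (refl : RelatorAut 1)).toMulEquiv.toMonoidHom =
      TrisectionKernels.stabilizeOne (fun i => (K i).map A.toMulEquiv.toMonoidHom) x i := by
  rw [TrisectionKernels.stabilizeOne_eq_connectSum, TrisectionKernels.stabilizeOne_eq_connectSum,
    map_blockSum_connectSum]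
  congr 1
  funext i
  exact map_toMulEquiv_refl _

/-! ## 2. Normal generators of a double unbalanced stabilisation -/

/-- Two unbalanced inclusions compose to `genInclAdd g 2`. [folklore] -/
theorem genInclAdd_comp_genInclAdd (g : ℕ) :
    (genInclAdd (g + 1) 1).comp (genInclAdd g 1) = genInclAdd g 2 := by
  refine FreeGroup.ext_hom _ _ fun p => ?_
  simp only [MonoidHom.comp_apply, genInclAdd_of]
  congr 1

/-- The first new handle is handle `g`: `ι σ (x₀) = σ₂ (x₀)`. [folklore] -/
theorem genInclAdd_genShiftAdd_of_two (g : ℕ) (b : Bool) :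
    genInclAdd (g + 1) 1 (genShiftAdd g 1 (FreeGroup.of (((0 : Fin 1), b) : surfaceGen 1))) =
      genShiftAdd g 2 (FreeGroup.of (((0 : Fin 2), b) : surfaceGen 2)) := by
  simp only [genInclAdd_of, genShiftAdd_of]
  congr 1

/-- The second new handle is handle `g + 1`: `σ (x₀) = σ₂ (x₁)`. [folklore] -/
theorem genShiftAdd_of_eq_genShiftAdd_two (g : ℕ) (b : Bool) :
    genShiftAdd (g + 1) 1 (FreeGroup.of (((0 : Fin 1), b) : surfaceGen 1)) =
      genShiftAdd g 2 (FreeGroup.of (((1 : Fin 2), b) : surfaceGen 2)) := by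
  simp only [genShiftAdd_of]
  congr 1

/-- **Normal generators of a double unbalanced stabilisation**: `((K.stabilizeOne x).stabilizeOne y)_ι`
is the normal closure of the lifts of `K_ι` on the first `g` handles and the two new generators
`x₀ ∈ {a_g, b_g}` (`b` iff `ι = x`) and `x₁ ∈ {a_{g+1}, b_{g+1}}` (`b` iff `ι = y`). [folklore] -/
theorem stabilizeOne_stabilizeOne_apply_eq (K : TrisectionKernels g) (x y ι : Fin 3) :
    (K.stabilizeOne x).stabilizeOne y ι = normalClosure
      ((PresentedGroup.mk _ ∘ genInclAdd g 2) ''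
          ((PresentedGroup.mk _) ⁻¹' (K ι : Set (SurfaceGroup g))) ∪
        {PresentedGroup.mk _ (genShiftAdd g 2
            (FreeGroup.of (((0 : Fin 2), decide (ι = x)) : surfaceGen 2))),
          PresentedGroup.mk _ (genShiftAdd g 2
            (FreeGroup.of (((1 : Fin 2), decide (ι = y)) : surfaceGen 2)))}) := by
  rw [(K.stabilizeOne x).stabilizeOne_apply_eq y ι, K.preimage_mk_stabilizeOne x ι,
    ← MonoidHom.coe_comp, normalClosure_image_normalClosure_union,
    Set.image_union, Set.image_union, Set.image_singleton, Set.image_singleton, Set.image_image]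
  -- drop the relator `r_{g+1}` of the middle level: it is `(σ r_1)⁻¹` up to `r_{g+2}`
  have hrel : ((PresentedGroup.mk ({surfaceRelator (g + 1 + 1)} :
        Set (FreeGroup (surfaceGen (g + 1 + 1))))).comp (genInclAdd (g + 1) 1))
        (surfaceRelator (g + 1)) ∈ normalClosure
      {PresentedGroup.mk ({surfaceRelator (g + 1 + 1)} : Set (FreeGroup (surfaceGen (g + 1 + 1))))
        (genShiftAdd (g + 1) 1 (FreeGroup.of (((0 : Fin 1), decide (ι = y)) : surfaceGen 1)))} := by
    rw [MonoidHom.comp_apply,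
      eq_inv_of_mul_eq_one_left (mk_genInclAdd_surfaceRelator_mul_mk_genShiftAdd (g + 1) 1)]
    refine inv_mem ?_
    exact map_surfaceRelator_one_mem_normalClosure
      ((PresentedGroup.mk _).comp (genShiftAdd (g + 1) 1)) (decide (ι = y))
  rw [show ∀ (A B C D : Set (SurfaceGroup (g + 1 + 1))), A ∪ B ∪ C ∪ D = (A ∪ B ∪ D) ∪ C from
    fun A B C D => by ext; simp only [Set.mem_union]; tauto,
    normalClosure_union_eq_of_subset (by
      rintro _ ⟨_, rfl, rfl⟩
      exact normalClosure_mono (Set.subset_union_right) hrel)]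
  congr 1
  ext z
  simp only [Set.mem_union, Set.mem_image, Set.mem_singleton_iff, Set.mem_insert_iff,
    MonoidHom.coe_comp, Function.comp_apply]
  constructor
  · rintro ((⟨w, hw, rfl⟩ | rfl) | rfl)
    · refine Or.inl ⟨w, hw, ?_⟩
      rw [← genInclAdd_comp_genInclAdd, MonoidHom.comp_apply]
    · exact Or.inr (Or.inl (by rw [genInclAdd_genShiftAdd_of_two]))
    · exact Or.inr (Or.inr (by rw [genShiftAdd_of_eq_genShiftAdd_two]))
  · rintro (⟨w, hw, rfl⟩ | rfl | rfl)
    · refine Or.inl (Or.inl ⟨w, hw, ?_⟩)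
      rw [← genInclAdd_comp_genInclAdd, MonoidHom.comp_apply]
    · exact Or.inl (Or.inr (by rw [genInclAdd_genShiftAdd_of_two]))
    · exact Or.inr (by rw [genShiftAdd_of_eq_genShiftAdd_two])

/-! ## 3. The relator-fixing transposition of two adjacent handles -/

/-- the block sum on the first block (inverse). [folklore] -/
theorem blockSum_inv_genInclAdd {h : ℕ} (A : RelatorAut g) (B : RelatorAut h)
    (w : FreeGroup (surfaceGen g)) :
    (A.blockSum B).inv (genInclAdd g h w) = genInclAdd g h (A.inv w) :=
  DFunLike.congr_fun (freeExtend_comp_genInclAdd ((genInclAdd g h).comp A.inv)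
    ((genShiftAdd g h).comp B.inv)) w

/-- the block sum on the second block (inverse). [folklore] -/
theorem blockSum_inv_genShiftAdd {h : ℕ} (A : RelatorAut g) (B : RelatorAut h)
    (w : FreeGroup (surfaceGen h)) :
    (A.blockSum B).inv (genShiftAdd g h w) = genShiftAdd g h (B.inv w) :=
  DFunLike.congr_fun (freeExtend_comp_genShiftAdd ((genInclAdd g h).comp A.inv)
    ((genShiftAdd g h).comp B.inv)) w

/-- **The relator-fixing transposition of the two handles of `Σ₂`**: `a₀ ↦ [a₀,b₀] a₁ [a₀,b₀]⁻¹`,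
`b₀ ↦ [a₀,b₀] b₁ [a₀,b₀]⁻¹`, `a₁ ↦ a₀`, `b₁ ↦ b₀` (inverse `a₀ ↦ a₁`, `b₀ ↦ b₁`,
`a₁ ↦ [a₁,b₁]⁻¹ a₀ [a₁,b₁]`, `b₁ ↦ [a₁,b₁]⁻¹ b₀ [a₁,b₁]`) fixes `[a₀,b₀][a₁,b₁]` on the nose; recorded
as: it carries each generator of one handle to a conjugate of the same generator of the other
handle (all identities by `decide` in the free group). [folklore] -/
theorem exists_swapTwo :
    ∃ S : RelatorAut 2,
      (∀ b : Bool, ∃ c, S.hom (FreeGroup.of ((0 : Fin 2), b)) = c * FreeGroup.of ((1 : Fin 2), b) * c⁻¹) ∧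
      (∀ b : Bool, ∃ c, S.hom (FreeGroup.of ((1 : Fin 2), b)) = c * FreeGroup.of ((0 : Fin 2), b) * c⁻¹) ∧
      (∀ b : Bool, ∃ c, S.inv (FreeGroup.of ((0 : Fin 2), b)) = c * FreeGroup.of ((1 : Fin 2), b) * c⁻¹) ∧
      (∀ b : Bool, ∃ c, S.inv (FreeGroup.of ((1 : Fin 2), b)) = c * FreeGroup.of ((0 : Fin 2), b) * c⁻¹) := by
  -- the two commutators and the generator images
  let c0 : FreeGroup (surfaceGen 2) := FreeGroup.of ((0 : Fin 2), false) * FreeGroup.of ((0 : Fin 2), true) *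
    (FreeGroup.of ((0 : Fin 2), false))⁻¹ * (FreeGroup.of ((0 : Fin 2), true))⁻¹
  let c1 : FreeGroup (surfaceGen 2) := FreeGroup.of ((1 : Fin 2), false) * FreeGroup.of ((1 : Fin 2), true) *
    (FreeGroup.of ((1 : Fin 2), false))⁻¹ * (FreeGroup.of ((1 : Fin 2), true))⁻¹
  let f : surfaceGen 2 → FreeGroup (surfaceGen 2) := fun x =>
    if x.1 = 0 then c0 * FreeGroup.of ((1 : Fin 2), x.2) * c0⁻¹ else FreeGroup.of ((0 : Fin 2), x.2)
  let finv : surfaceGen 2 → FreeGroup (surfaceGen 2) := fun x =>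
    if x.1 = 0 then FreeGroup.of ((1 : Fin 2), x.2) else c1⁻¹ * FreeGroup.of ((0 : Fin 2), x.2) * c1
  have h1 : FreeGroup.lift f (surfaceRelator 2) = surfaceRelator 2 := by decide
  have h2 : FreeGroup.lift finv (surfaceRelator 2) = surfaceRelator 2 := by decide
  have h3 : ∀ x, FreeGroup.lift finv (f x) = FreeGroup.of x := by decide
  have h4 : ∀ x, FreeGroup.lift f (finv x) = FreeGroup.of x := by decide
  refine ⟨⟨FreeGroup.lift f, FreeGroup.lift finv, h1, h2,
    FreeGroup.ext_hom _ _ fun x => by simp [h3], FreeGroup.ext_hom _ _ fun x => by simp [h4]⟩,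
    fun b => ⟨c0, ?_⟩, fun b => ⟨1, ?_⟩, fun b => ⟨1, ?_⟩, fun b => ⟨c1⁻¹, ?_⟩⟩
  · simp [f]
  · simp [f]
  · simp [finv]
  · simp [finv, mul_assoc]

/-- **Adjacent eyes commute up to a relator-fixing automorphism of the surface group**: the block
sum of the identity on the first `g` handles with the transposition of the two new handles carries
`(K.stabilizeOne x).stabilizeOne y` onto `(K.stabilizeOne y).stabilizeOne x`, slot by slot, for
every kernel triple `K` and all directions `x, y` (genus `g + 1 + 1 = g + 2` definitionally).
[folklore] -/
theorem exists_swap_stabilizeOne (g : ℕ) :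
    ∃ S : RelatorAut (g + 2), ∀ (K : TrisectionKernels g) (x y ι : Fin 3),
      ((K.stabilizeOne x).stabilizeOne y ι).map S.toMulEquiv.toMonoidHom =
        (K.stabilizeOne y).stabilizeOne x ι := by
  obtain ⟨S₂, ha, hb, ha', hb'⟩ := exists_swapTwo
  refine ⟨(refl : RelatorAut g).blockSum S₂, fun K x y ι => ?_⟩
  rw [stabilizeOne_stabilizeOne_apply_eq, stabilizeOne_stabilizeOne_apply_eq]
  refine map_normalClosure_eq_of _ _ _ ?_ ?_
  · rintro z (⟨w, hw, rfl⟩ | rfl | rfl)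
    · refine subset_normalClosure (Or.inl ⟨w, hw, ?_⟩)
      simp only [Function.comp_apply, toMulEquiv_mk]
      rw [blockSum_hom_genInclAdd]
      rfl
    · obtain ⟨c, hc⟩ := ha (decide (ι = x))
      rw [toMulEquiv_mk, blockSum_hom_genShiftAdd, hc, map_mul, map_mul, map_inv, map_mul, map_mul,
        map_inv]
      exact conj_mem_nc _ _ (subset_normalClosure (Or.inr (Or.inr rfl)))
    · obtain ⟨c, hc⟩ := hb (decide (ι = y))
      rw [toMulEquiv_mk, blockSum_hom_genShiftAdd, hc, map_mul, map_mul, map_inv, map_mul, map_mul,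
        map_inv]
      exact conj_mem_nc _ _ (subset_normalClosure (Or.inr (Or.inl rfl)))
  · rintro z (⟨w, hw, rfl⟩ | rfl | rfl)
    · refine subset_normalClosure (Or.inl ⟨w, hw, ?_⟩)
      simp only [Function.comp_apply, toMulEquiv_symm_mk]
      rw [blockSum_inv_genInclAdd]
      rfl
    · obtain ⟨c, hc⟩ := ha' (decide (ι = y))
      rw [toMulEquiv_symm_mk, blockSum_inv_genShiftAdd, hc, map_mul, map_mul, map_inv, map_mul,
        map_mul, map_inv]
      exact conj_mem_nc _ _ (subset_normalClosure (Or.inr (Or.inr rfl)))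
    · obtain ⟨c, hc⟩ := hb' (decide (ι = x))
      rw [toMulEquiv_symm_mk, blockSum_inv_genShiftAdd, hc, map_mul, map_mul, map_inv, map_mul,
        map_mul, map_inv]
      exact conj_mem_nc _ _ (subset_normalClosure (Or.inr (Or.inl rfl)))

/-! ## 4. Pattern lists: iterated unbalanced stabilisations and handle permutations -/

/-- The kernel triple of a PATTERN LIST: starting from the genus-`0` triple, stabilise once in
direction `x` for each entry `x` of the list (head = last handle). -/
local notation3 "𝒫 " arg:max => (List.rec (motive := fun t => TrisectionKernels (List.length t))
  trivialKernels (fun hd _ K => TrisectionKernels.stabilizeOne K hd) arg)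

/-- Unfolding `𝒫` on a cons. [folklore] -/
theorem patL_cons (x : Fin 3) (l : List (Fin 3)) : 𝒫 (x :: l) = (𝒫 l).stabilizeOne x := rfl

/-- Unfolding `𝒫` on the empty list. [folklore] -/
theorem patL_nil : 𝒫 ([] : List (Fin 3)) = trivialKernels := rfl

/-- Transport commutes with unbalanced stabilisation. [folklore] -/
theorem cast_stabilizeOne {g₁ g₂ : ℕ} (h : g₁ = g₂) (h' : g₁ + 1 = g₂ + 1) (K : TrisectionKernels g₁)
    (x : Fin 3) : (K.stabilizeOne x).cast h' = (K.cast h).stabilizeOne x := by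
  subst h; rfl

/-- A realiser transports along an equality of genera. [folklore] -/
theorem exists_realiser_cast {g₁ g₂ : ℕ} (h : g₁ = g₂) {K K' : TrisectionKernels g₁}
    (hA : ∃ A : RelatorAut g₁, ∀ ι, (K ι).map A.toMulEquiv.toMonoidHom = K' ι) :
    ∃ A : RelatorAut g₂, ∀ ι, ((K.cast h) ι).map A.toMulEquiv.toMonoidHom = (K'.cast h) ι := by
  subst h; exact hA

/-- **Handle permutations are realised by relator-fixing automorphisms**: if two pattern lists are
permutations of each other, a relator-fixing automorphism of the surface group carries the kernel
triple of the first (transported along the equality of lengths) onto that of the second, slot by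
slot.  Induction on `List.Perm`: a common new handle rides in a block sum with the identity
(`map_blockSum_refl_stabilizeOne`), an adjacent transposition is `exists_swap_stabilizeOne`.
[folklore] -/
theorem exists_realiser_of_perm {l₁ l₂ : List (Fin 3)} (hp : l₁.Perm l₂) :
    ∃ A : RelatorAut l₂.length,
      ∀ ι, (((𝒫 l₁).cast hp.length_eq) ι).map A.toMulEquiv.toMonoidHom = (𝒫 l₂) ι := by
  induction hp with
  | nil => exact ⟨refl, fun ι => map_toMulEquiv_refl _⟩
  | @cons x l₁ l₂ h ih =>
    obtain ⟨A, hA⟩ := ih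
    refine ⟨A.blockSum refl, fun ι => ?_⟩
    rw [patL_cons, patL_cons, cast_stabilizeOne h.length_eq, map_blockSum_refl_stabilizeOne]
    congr 1
    funext i
    exact hA i
  | swap x y l =>
    obtain ⟨S, hS⟩ := exists_swap_stabilizeOne l.length
    exact ⟨S, fun ι => hS (𝒫 l) x y ι⟩
  | @trans l₁ l₂ l₃ h₁ h₂ ih₁ ih₂ =>
    obtain ⟨A₁, hA₁⟩ := exists_realiser_cast h₂.length_eq ih₁
    obtain ⟨A₂, hA₂⟩ := ih₂
    -- transport of a transport (`cast_cast` of `AgkCor6Sufficiency/Negative/DownwardClosed.lean`,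
    -- restated locally to keep this file independent of the route file)
    have hcc : ∀ {g₁ g₂ g₃ : ℕ} (K : TrisectionKernels g₁) (h : g₁ = g₂) (h' : g₂ = g₃),
        (K.cast h).cast h' = K.cast (h.trans h') := by
      intro g₁ g₂ g₃ K h h'; subst h; subst h'; rfl
    refine ⟨A₁.trans A₂, fun ι => ?_⟩
    rw [map_toMulEquiv_trans, ← hcc _ h₁.length_eq h₂.length_eq, hA₁, hA₂]

end Summit.SmoothPoincare4.SmoothPoincare4.Theorems.NormalFormStablyTrivial.Sketch

end
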